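import Summits.BirchSwinnertonDyer.BirchSwinnertonDyer.Theorems.PotSupersingularWildLowerClassTransport
import Literature.NumberTheory.EllipticCurves.SkinnerUrban2014.PAdicUnitPeriodRatioProofs
import Literature.NumberTheory.EllipticCurves.ShaPrimaryIsogenyProofs
import Literature.NumberTheory.EllipticCurves.BSDRootNumberSmallConductorProofs
import HarnessLib

/-!
# Cell `bsd-potss`, rungs K9 / K8-t′: on an IRREDUCIBLE class `ord_p #Ш_an` is an isogeny invariant,
# so the "intrinsic class" hypothesis of the open cores is a per-curve condition there — a ROUTE-FREE
# module (imports no `Theses.*`; seat bsd-potss-k9-c2, generation 6)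

The open core 19663 `WildLowerIntrinsicNonCM` of rung K9 (and its registered BC3 stubs
`stub_intr_irred_fwLocus`, `stub_intr_kimRows`, `stub_intr_irred_residual`) carries the hypothesis that the
WHOLE isogeny class of `W` is intrinsic at `3`: every globally minimal `W' ∼_ℚ W` has `ord₃ #Ш_an(W') > 0`.
Generation 5 listed the simplification of this ∀-quantifier on the irreducible (X4) rows as "not attempted
(needs isogeny factorisation + `Ш[3^∞]` transport)". Both ingredients are theorems of the tree
(`SkinnerUrban2014.exists_isogeny_not_dvd_degree_of_irreducible`: `E[p]` irreducible ⇒ every isogenous curve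
is reached by an isogeny of degree prime to `p`, Silverman *AEC* III.4.11; and
`Isogeny.natCard_primaryComponent_sha_eq`: `#Ш[p^∞]` is invariant along an isogeny of degree prime to `p`,
Milne *ADT* I.7.1(b)), so this file proves, type-blind and at EVERY prime `p`:

* §1 `padicValNat_shaOrder_eq_of_isIsogenous_of_irr` — `E[p]` irreducible, `W ∼ W'`, both `Ш` finite ⇒
  `ord_p #Ш(W) = ord_p #Ш(W')`;
* §2 `padicValRat_shaAn_eq_of_isIsogenous_of_irr` — with Cassels `hC`, GZK `hG`, modularity `hM`, analytic rank
  `0`, globally minimal members and rational `#Ш_an`: **`ord_p #Ш_an(W) = ord_p #Ш_an(W')`** (Cassels' defect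
  identity `TwistComparison.defectAgreeAt_of_isIsogenous` + §1) — on an irreducible class the analytic order of
  `Ш` has the SAME `p`-adic valuation at every member;
* §3 `forall_isIsogenous_shaAn_pos_iff_of_irr` — hence the intrinsic-class hypothesis is EQUIVALENT (mod the
  three inputs) to the per-curve condition `∀ q, #Ш_an(W) = q → 0 < ord_p q`; in particular an irreducible
  class containing one curve with `p ∣ #Ш_an` has NO unit member: the unit-member transport
  (`missingLowerBoundAt_rankZero_of_isIsogenous_unitMember`, p439340) closes nothing on X4 rows — all its
  instances (census: 383 wild classes at `3`; the route's T3 witness 4914n1) are reducible (X3) classes, and the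
  `Ш_an`-minimal member of p444599/p447017 is EVERY member on X4, so the non-minimal-member divisibility of
  p451755 §2 is void there (it lives on the 144 intrinsic X3 classes of the 1 770);
* §4 (p = 3, the 19663 body spelled VERBATIM on its `Irr W 3` rows) `wild_intrinsicIrrRows_iff_curveIrrRows` —
  modulo Cassels/GZK/modularity, the open core restricted to irreducible rows is equivalent to the PER-CURVE
  statement «every non-CM wild analytic-rank-`0` curve `W` with `E[3]` irreducible and `0 < ord₃ #Ш_an(W)` (for
  its rational `#Ш_an`) satisfies `MissingLowerBoundAt W 3`» — no class quantifier; this is the form in which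
  the three irreducible stubs of the registered skeleton may be read (their `Intrinsic W` binder is redundant
  with `0 < ord₃ #Ш_an(W)`).

CONDITIONAL on the named published facts where stated; restatement/bookkeeping — it changes no verdict (the
irreducible intrinsic rows remain Kato's Conj. 12.10 lower inclusion at the additive prime `3`, open); nothing is
booked; BSD is not proved by any of this.

References: [SilvermanAEC2009] Cor. III.4.11, Thm. III.6.1–6.2; [MilneADT2006] Ch. I Lemma 7.1(b) (p. 96),
Thm. I.7.3; [Cassels1965ArithmeticVIII]; [GreenbergVatsal2000] §3 Remark 3.4; [Miller2011LMS] §1, Def. 1.1;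
[Kato2004Asterisque] Conj. 12.10 (p. 224).
-/

set_option autoImplicit false
-- sibling precedent (`PotSupersingularWildLowerClassTransport.lean`): the directory name repeats the summit name
set_option linter.dupNamespace false

noncomputable section

open scoped Classical

namespace Summit.BirchSwinnertonDyer.BirchSwinnertonDyer.Theorems

open WeierstrassCurve Literature.NumberTheory.EllipticCurves
  Literature.NumberTheory.EllipticCurves.Rank1Residual
  Literature.NumberTheory.EllipticCurves.Rank1Residual.Typed
  Summit.BirchSwinnertonDyer.Rank1Residual.Additive
  Summit.BirchSwinnertonDyer.Rank1Residual

/-! ## §1 `ord_p #Ш` is a class invariant when `E[p]` is irreducible -/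

section ShaOrder

variable (W W' : WeierstrassCurve ℚ) [W.IsElliptic] [W'.IsElliptic] (p : ℕ) [Fact p.Prime]

/-- `ord_p #Ш(W) = ord_p #Ш(W')` along an isogeny of degree prime to `p`, both `Ш` finite
(`#Ш[p^∞]` agree: `Isogeny.natCard_primaryComponent_sha_eq`; `ord_p #A = ord_p #A[p^∞]`).
[cite: MilneADT2006, Ch. I Lemma 7.1(b) (proof), p. 96] -/
theorem padicValNat_shaOrder_eq_of_isogeny_not_dvd_degree (φ : Isogeny W W') (hp : ¬ p ∣ φ.degree)
    (hfin : W.ShaFinite) (hfin' : W'.ShaFinite) :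
    padicValNat p W.shaOrder = padicValNat p W'.shaOrder := by
  haveI : Finite W.sha := hfin
  haveI : Finite W'.sha := hfin'
  rw [WeierstrassCurve.shaOrder, WeierstrassCurve.shaOrder,
    ← padicValNat_card_addPrimaryComponent (A := W.sha) p,
    ← padicValNat_card_addPrimaryComponent (A := W'.sha) p, φ.natCard_primaryComponent_sha_eq p hp]

/-- **`ord_p #Ш` is constant on an isogeny class with `E[p]` irreducible** (both `Ш` finite): an irreducible
`W[p]` forces an isogeny `W → W'` of degree prime to `p` onto every isogenous `W'`
(`SkinnerUrban2014.exists_isogeny_not_dvd_degree_of_irreducible`, Silverman *AEC* Cor. III.4.11), along which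
`#Ш[p^∞]` is invariant. [cite: SilvermanAEC2009, Cor. III.4.11] [cite: MilneADT2006, Ch. I Lemma 7.1(b), p. 96]
[cite: GreenbergVatsal2000, §3, Remark 3.4] -/
theorem padicValNat_shaOrder_eq_of_isIsogenous_of_irr (hirr : W.HasIrreducibleModPGaloisRep p)
    (hiso : IsIsogenous W W') (hfin : W.ShaFinite) (hfin' : W'.ShaFinite) :
    padicValNat p W.shaOrder = padicValNat p W'.shaOrder := by
  have hp0 : (p : ℚ) ≠ 0 := by exact_mod_cast (Fact.out : p.Prime).ne_zero
  obtain ⟨φ, hφ⟩ := SkinnerUrban2014.exists_isogeny_not_dvd_degree_of_irreducible (W := W) (W' := W')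
    hp0 hirr hiso
  exact padicValNat_shaOrder_eq_of_isogeny_not_dvd_degree W W' p φ hφ hfin hfin'

end ShaOrder

/-! ## §2 `ord_p #Ш_an` is a class invariant when `E[p]` is irreducible (analytic rank `0`) -/

section ShaAn

variable (W : WeierstrassCurve ℚ) [W.IsElliptic] [W.IsGloballyMinimal] (p : ℕ) [Fact p.Prime]
  (W' : WeierstrassCurve ℚ) [W'.IsElliptic] [W'.IsGloballyMinimal]

/-- **On an irreducible class `ord_p #Ш_an` is the same at every member.** For globally minimal `ℚ`-isogenous
`W ∼ W'` of analytic rank `0` with `W[p]` irreducible and rational `#Ш_an(W) = q`, `#Ш_an(W') = q'`: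
`ord_p q = ord_p q'`. Proof: Cassels' defect identity `ord_p q − ord_p #Ш(W) = ord_p q' − ord_p #Ш(W')`
(`exists_shaAn_eq_padicValRat_ge_of_isIsogenous`, over Cassels `hC`, GZK `hG` — both `Ш` finite — and
modularity `hM`) and §1 (`ord_p #Ш(W) = ord_p #Ш(W')`). [cite: Cassels1965ArithmeticVIII]
[cite: MilneADT2006, Thm. I.7.3 and Lemma I.7.1(b)] [cite: SilvermanAEC2009, Cor. III.4.11] -/
theorem padicValRat_shaAn_eq_of_isIsogenous_of_irr (hC : bsdRHS_eq_of_isIsogenous)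
    (hG : rank_eq_analyticRank_of_analyticRank_le_one) (hM : hasEntireLFunction_rat)
    (hr : W.analyticRank = 0) (hirr : W.HasIrreducibleModPGaloisRep p) (hiso : IsIsogenous W W')
    {q q' : ℚ} (hq : shaAn W = (q : ℂ)) (hq' : shaAn W' = (q' : ℂ)) :
    padicValRat p q = padicValRat p q' := by
  obtain ⟨r', hr', hδ⟩ := exists_shaAn_eq_padicValRat_ge_of_isIsogenous hC hG hM W p hr W' hiso hq
  have hrq : r' = q' := by exact_mod_cast hr'.symm.trans hq'
  subst hrq
  have hfin : W.ShaFinite := (hG W (by rw [hr]; exact zero_le_one)).2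
  have hra : W'.analyticRank = 0 := by rw [← analyticRank_eq_of_isIsogenous' hiso, hr]
  have hfin' : W'.ShaFinite := (hG W' (by rw [hra]; exact zero_le_one)).2
  have hv : padicValNat p W.shaOrder = padicValNat p W'.shaOrder :=
    padicValNat_shaOrder_eq_of_isIsogenous_of_irr W W' p hirr hiso hfin hfin'
  have hv' : (padicValNat p W.shaOrder : ℤ) = (padicValNat p W'.shaOrder : ℤ) := by exact_mod_cast hv
  omega

/-- Rationality and valuation transport together: if `#Ш_an(W) = q` then `#Ш_an(W') = q'` for a rational `q'`
with `ord_p q' = ord_p q` (irreducible `W[p]`, analytic rank `0`, Cassels/GZK/modularity).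
[cite: Cassels1965ArithmeticVIII] [cite: MilneADT2006, Thm. I.7.3] -/
theorem exists_shaAn_eq_padicValRat_eq_of_isIsogenous_of_irr (hC : bsdRHS_eq_of_isIsogenous)
    (hG : rank_eq_analyticRank_of_analyticRank_le_one) (hM : hasEntireLFunction_rat)
    (hr : W.analyticRank = 0) (hirr : W.HasIrreducibleModPGaloisRep p) (hiso : IsIsogenous W W')
    {q : ℚ} (hq : shaAn W = (q : ℂ)) :
    ∃ q' : ℚ, shaAn W' = (q' : ℂ) ∧ padicValRat p q' = padicValRat p q := by
  obtain ⟨q', hq', -⟩ := exists_shaAn_eq_padicValRat_ge_of_isIsogenous hC hG hM W p hr W' hiso hq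
  exact ⟨q', hq', (padicValRat_shaAn_eq_of_isIsogenous_of_irr W p W' hC hG hM hr hirr hiso hq hq').symm⟩

end ShaAn

/-! ## §3 The intrinsic-class hypothesis is a per-curve condition on irreducible rows -/

/-- **On an irreducible class, "every member has `ord_p #Ш_an > 0`" ⟺ "`ord_p #Ш_an(W) > 0` (if rational)".**
For `W` globally minimal of analytic rank `0` with `W[p]` irreducible, over Cassels `hC`, GZK `hG`, modularity
`hM`. (⇒) is the instance `W' := W`; (⇐) transports rationality from `W'` back to `W`
(`exists_shaAn_eq_padicValRat_ge_of_isIsogenous` along the symmetric isogeny) and uses §2. Consequence: an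
irreducible class containing one curve with `p ∣ #Ш_an` has no unit member — the unit-member transport closes
nothing on X4 rows. [cite: Cassels1965ArithmeticVIII] [cite: MilneADT2006, Thm. I.7.3]
[cite: SilvermanAEC2009, Cor. III.4.11] -/
theorem forall_isIsogenous_shaAn_pos_iff_of_irr (hC : bsdRHS_eq_of_isIsogenous)
    (hG : rank_eq_analyticRank_of_analyticRank_le_one) (hM : hasEntireLFunction_rat)
    (W : WeierstrassCurve ℚ) [W.IsElliptic] [W.IsGloballyMinimal] (p : ℕ) [Fact p.Prime]
    (hr : W.analyticRank = 0) (hirr : W.HasIrreducibleModPGaloisRep p) :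
    (∀ (W' : WeierstrassCurve ℚ) [W'.IsElliptic] [W'.IsGloballyMinimal], IsIsogenous W W' →
        ∀ q' : ℚ, shaAn W' = (q' : ℂ) → 0 < padicValRat p q') ↔
      ∀ q : ℚ, shaAn W = (q : ℂ) → 0 < padicValRat p q := by
  constructor
  · intro h q hq
    exact h W (isIsogenous_self W) q hq
  · intro h W' _ _ hiso q' hq'
    have hra : W'.analyticRank = 0 := by rw [← analyticRank_eq_of_isIsogenous' hiso, hr]
    obtain ⟨q, hq, -⟩ :=
      exists_shaAn_eq_padicValRat_ge_of_isIsogenous hC hG hM W' p hra W hiso.symm_of_charZero hq'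
    rw [← padicValRat_shaAn_eq_of_isIsogenous_of_irr W p W' hC hG hM hr hirr hiso hq hq']
    exact h q hq

/-! ## §4 The open core of rung K9 on its irreducible rows, per curve (p = 3) -/

/-- **19663 on its irreducible rows ⟺ a PER-CURVE statement** (mod Cassels `hC`, GZK `hG`, modularity `hM`).
Left: the body of `WildLowerIntrinsicNonCM` VERBATIM with the extra binder `Irr W 3` (the rows of the registered
stubs `stub_intr_irred_fwLocus` / `stub_intr_kimRows` / `stub_intr_irred_residual`). Right: «every non-CM wild
analytic-rank-`0` curve `W` with `W[3]` irreducible whose rational `#Ш_an(W)` has `0 < ord₃` satisfies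
`MissingLowerBoundAt W 3`» — no class quantifier (§3). Restatement convenience for the planner; the content is
unchanged (Kato's Conj. 12.10 lower inclusion at the additive prime `3`, open). [cite: Cassels1965ArithmeticVIII]
[cite: MilneADT2006, Thm. I.7.3] [cite: SilvermanAEC2009, Cor. III.4.11] [cite: Kato2004Asterisque, Conj. 12.10 (p. 224)] -/
theorem wild_intrinsicIrrRows_iff_curveIrrRows (hC : bsdRHS_eq_of_isIsogenous)
    (hG : rank_eq_analyticRank_of_analyticRank_le_one) (hM : hasEntireLFunction_rat) :
    (∀ (W : WeierstrassCurve ℚ) [W.IsElliptic] [W.IsGloballyMinimal] [Fact (3 : ℕ).Prime],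
      W.analyticRank = 0 → ClassO6 W 3 → Irr W 3 → ¬ W.HasCM →
      (∀ (W' : WeierstrassCurve ℚ) [W'.IsElliptic] [W'.IsGloballyMinimal], IsIsogenous W W' →
        ∀ q' : ℚ, shaAn W' = (q' : ℂ) → 0 < padicValRat 3 q') →
      MissingLowerBoundAt W 3) ↔
    (∀ (W : WeierstrassCurve ℚ) [W.IsElliptic] [W.IsGloballyMinimal] [Fact (3 : ℕ).Prime],
      W.analyticRank = 0 → ClassO6 W 3 → Irr W 3 → ¬ W.HasCM →
      (∀ q : ℚ, shaAn W = (q : ℂ) → 0 < padicValRat 3 q) → MissingLowerBoundAt W 3) := by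
  constructor
  · intro h W _ _ _ hr hO6 hirr hcm hpos
    exact h W hr hO6 hirr hcm
      ((forall_isIsogenous_shaAn_pos_iff_of_irr hC hG hM W 3 hr hirr).mpr hpos)
  · intro h W _ _ _ hr hO6 hirr hcm hI
    exact h W hr hO6 hirr hcm
      ((forall_isIsogenous_shaAn_pos_iff_of_irr hC hG hM W 3 hr hirr).mp hI)

/-- **The intrinsic-rows statement of 19663 from its reducible rows and the per-curve irreducible statement**
(no input needed in this direction): the ∀-over-the-class binder only matters on the REDUCIBLE (X3) rows — on X4
it may be replaced by the per-curve condition `0 < ord₃ #Ш_an(W)` (the converse replacement is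
`wild_intrinsicIrrRows_iff_curveIrrRows`, mod Cassels/GZK/modularity). `hred` = the body on `¬ Irr W 3` rows
(registered stub `stub_intr_red`, verbatim up to binder order); `hirr` = the per-curve irreducible statement.
Bookkeeping. [cite: MilneADT2006, Thm. I.7.3] [cite: SilvermanAEC2009, Cor. III.4.11]
[cite: Kato2004Asterisque, Conj. 12.10 (p. 224)] -/
theorem wild_intrinsicNonCMRows_of_red_of_curveIrrRows
    (hred : ∀ (W : WeierstrassCurve ℚ) [W.IsElliptic] [W.IsGloballyMinimal] [Fact (3 : ℕ).Prime],
      W.analyticRank = 0 → ClassO6 W 3 → ¬ Irr W 3 → ¬ W.HasCM →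
      (∀ (W' : WeierstrassCurve ℚ) [W'.IsElliptic] [W'.IsGloballyMinimal], IsIsogenous W W' →
        ∀ q' : ℚ, shaAn W' = (q' : ℂ) → 0 < padicValRat 3 q') →
      MissingLowerBoundAt W 3)
    (hirr : ∀ (W : WeierstrassCurve ℚ) [W.IsElliptic] [W.IsGloballyMinimal] [Fact (3 : ℕ).Prime],
      W.analyticRank = 0 → ClassO6 W 3 → Irr W 3 → ¬ W.HasCM →
      (∀ q : ℚ, shaAn W = (q : ℂ) → 0 < padicValRat 3 q) → MissingLowerBoundAt W 3) :
    ∀ (W : WeierstrassCurve ℚ) [W.IsElliptic] [W.IsGloballyMinimal] [Fact (3 : ℕ).Prime],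
      W.analyticRank = 0 → ClassO6 W 3 → ¬ W.HasCM →
      (∀ (W' : WeierstrassCurve ℚ) [W'.IsElliptic] [W'.IsGloballyMinimal], IsIsogenous W W' →
        ∀ q' : ℚ, shaAn W' = (q' : ℂ) → 0 < padicValRat 3 q') →
      MissingLowerBoundAt W 3 := by
  intro W _ _ _ hr hO6 hcm hI
  by_cases hi : Irr W 3
  · exact hirr W hr hO6 hi hcm fun q hq ↦ hI W (isIsogenous_self W) q hq
  · exact hred W hr hO6 hi hcm hI

end Summit.BirchSwinnertonDyer.BirchSwinnertonDyer.Theorems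

end
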